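import Summits.ResolutionOfSingularities.ResolutionOfSingularities.Theorems.FrobeniusLadderFInjectiveMacaulayficationX2CubicFormTStep
import Mathlib.RingTheory.MvPolynomial.Homogeneous
import HarnessLib

/-!
# T-side CLASS ROW, FRONT END: from a CUBIC FORM `F(y,u,t,s)` to the chart hypotheses — `TStepInstanceAt` for `Y = {x² + F = 0}` whenever `f` is prime, `Y` is regular off the vertex,
# and the four dehomogenisations of `F` are prime with smooth zero locus
# (crux `FInjectiveMacaulayfication` stmt-ResolutionOfSingularities-15315, chain w45a; front end of ✓ `X2CubicFormTStep.tStepInstanceAt_of_doublePoint_cubicCharts`: the strict transforms, their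
# shape, `f ∉ (Xᵢ)` and `constantCoeff f = 0` are DERIVED from the homogeneity of `F`; seat res-L1-w45a-lead-1 g11)

[OURS · L1 W4.5a] Support file (`--supports stmt-ResolutionOfSingularities-15315 --as helper`); def-free; UNCONDITIONAL; no named fact; NOT a statement of any manuscript. Class-level
instance theorem; T″ and the F-half stay OPEN; nothing of the crux is proved. AI-written (AI review is weaker than expert review).

`F ∈ k[Y₀..Y₃]` homogeneous of degree `3`, `f = X₄² + F(X₀..X₃)` (`rename Fin.castSucc`). Dehomogenisations `w a = aeval (σ a) F ∈ k[Z₀,Z₁,Z₂]`, `σ a` = «`Y_a ↦ 1`, the other three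
variables in increasing order» (`σ = (1,Z₀,Z₁,Z₂), (Z₀,1,Z₁,Z₂), (Z₀,Z₁,1,Z₂), (Z₀,Z₁,Z₂,1)`).
* §1 `aeval_mul_of_isHomogeneous` — `aeval (c·g) F = cⁿ·aeval g F` for `F` homogeneous of degree `n` (the scaling identity); `pderiv_rename_castSucc` (`∂₄` kills `k[X₀..X₃]`);
  `constantCoeff_eq_zero_of_isHomogeneous`.
* §2 the strict transforms of `f`: `theta_four` (`θ₄ f = X₄²·(1 + X₄·F)`), `theta_castSucc` (`θ_a f = X_a²·(X₄² + X_a·rename (e a) (w a))`, `a ≤ 3`), `f_not_mem_span_X`,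
  `constantCoeff_f`.
* §3 ★★★ `tStepInstanceAt_of_doublePoint_cubicForm` — for every field `k`, every `p`, every cubic form `F` with `f = X₄² + F` PRIME, `Y` regular off `v`, and the four `w a` PRIME with
  SMOOTH zero locus (pointwise derivations): `TStepGerm.TStepInstanceAt p v (𝔪̃·𝒪_{Y,v})`. (T-instance #2 ✓p676607 = the Fermat form `F = ΣY_j³`.)
[folklore; cite: GortzWedhorn2020, Prop. 13.91 (2); Liu2002, Thm. 8.1.19 (a); Kollar2007, §2.5 (strict transforms under point blow-ups)]
-/

-- single-problem summit: the doubled namespace component is forced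
set_option linter.dupNamespace false

noncomputable section

namespace Summit.ResolutionOfSingularities.ResolutionOfSingularities.Theorems.FInjectiveMacaulayfication.X2CubicFormFrontEnd

open MvPolynomial Literature.AlgebraicGeometry.Resolution AlgebraicGeometry
open Summit.ResolutionOfSingularities.ResolutionOfSingularities.Theorems.FInjectiveMacaulayfication

/-! ## §1 Homogeneous scaling, and two small facts about `rename Fin.castSucc` -/

/-- **Scaling identity for homogeneous polynomials**: `aeval (fun j => c * g j) F = c ^ n * aeval g F` for `F` homogeneous of degree `n`. [folklore] -/
theorem aeval_mul_of_isHomogeneous {σ R A : Type*} [CommSemiring R] [CommSemiring A] [Algebra R A] {F : MvPolynomial σ R} {n : ℕ} (hF : F.IsHomogeneous n)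
    (c : A) (g : σ → A) : aeval (fun j => c * g j) F = c ^ n * aeval g F := by
  classical
  conv_lhs => rw [F.as_sum]
  conv_rhs => rw [F.as_sum]
  rw [map_sum, map_sum, Finset.mul_sum]
  refine Finset.sum_congr rfl fun β hβ => ?_
  rw [aeval_monomial, aeval_monomial, Finsupp.prod, Finsupp.prod]
  simp_rw [mul_pow, Finset.prod_mul_distrib, Finset.prod_pow_eq_pow_sum, ← hF.degree_eq_sum_deg_support hβ]
  ring

/-- `∂₄` kills every polynomial coming from `k[X₀..X₃]`. [elementary] -/
theorem pderiv_rename_castSucc (k : Type) [Field k] (P : MvPolynomial (Fin 4) k) : pderiv 4 (rename (Fin.castSucc : Fin 4 → Fin 5) P) = 0 := by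
  induction P using MvPolynomial.induction_on with
  | C c => rw [rename_C, pderiv_C]
  | add p q hp hq => rw [map_add, map_add, hp, hq, add_zero]
  | mul_X p j hp =>
      rw [map_mul, rename_X, Derivation.leibniz, hp, smul_zero, add_zero, pderiv_X_of_ne, smul_zero]
      exact fun h => by have := congrArg Fin.val h; simp at this; omega

/-- A homogeneous polynomial of positive degree has no constant term. [elementary] -/
theorem constantCoeff_eq_zero_of_isHomogeneous {σ R : Type*} [CommSemiring R] {F : MvPolynomial σ R} {n : ℕ} (hF : F.IsHomogeneous n) (hn : n ≠ 0) :
    constantCoeff F = 0 := by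
  rw [constantCoeff_eq, hF.coeff_eq_zero]
  rw [map_zero]
  exact hn.symm

/-! ## §2 The strict transforms of `f = X₄² + F(X₀..X₃)` under the point blow-up -/

variable (k : Type) [Field k]

/-- **The `x`-chart**: `θ₄ f = X₄²·(1 + X₄·F)` (`F` cubic: `F(X₀X₄, …, X₃X₄) = X₄³·F`). [folklore; cite: Kollar2007, §2.5] -/
theorem theta_four (F : MvPolynomial (Fin 4) k) (hF : F.IsHomogeneous 3) (f : MvPolynomial (Fin 5) k) (hf : f = X 4 ^ 2 + rename (Fin.castSucc : Fin 4 → Fin 5) F) :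
    MvPolynomial.aeval (fun j : Fin 5 => if j = (4 : Fin 5) then (X 4 : MvPolynomial (Fin 5) k) else X j * X 4) f =
      X 4 ^ 2 * (1 + X 4 * rename (Fin.castSucc : Fin 4 → Fin 5) F) := by
  have hcomp : MvPolynomial.aeval (fun j : Fin 5 => if j = (4 : Fin 5) then (X 4 : MvPolynomial (Fin 5) k) else X j * X 4) (rename (Fin.castSucc : Fin 4 → Fin 5) F) =
      MvPolynomial.aeval (fun j : Fin 4 => (X 4 : MvPolynomial (Fin 5) k) * X (Fin.castSucc j)) F := by
    rw [aeval_rename, show ((fun j : Fin 5 => if j = (4 : Fin 5) then (X 4 : MvPolynomial (Fin 5) k) else X j * X 4) ∘ Fin.castSucc) =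
      (fun j : Fin 4 => (X 4 : MvPolynomial (Fin 5) k) * X (Fin.castSucc j)) from funext fun j => by
        have hj4 : Fin.castSucc j ≠ (4 : Fin 5) := (Fin.castSucc_lt_last j).ne
        simp only [Function.comp_apply]; rw [if_neg hj4, mul_comm]]
  have hscale := aeval_mul_of_isHomogeneous hF (X 4 : MvPolynomial (Fin 5) k) (fun j : Fin 4 => (X (Fin.castSucc j) : MvPolynomial (Fin 5) k))
  have hid : MvPolynomial.aeval (fun j : Fin 4 => (X (Fin.castSucc j) : MvPolynomial (Fin 5) k)) F = rename (Fin.castSucc : Fin 4 → Fin 5) F := by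
    show MvPolynomial.aeval (X ∘ Fin.castSucc) F = _
    rw [← aeval_rename, aeval_X_left_apply]
  rw [hf, map_add, map_pow, aeval_X, if_pos rfl, hcomp, hscale, hid]
  ring

/-- **The four singular charts**: `θ_a f = X_a²·(X₄² + X_a · rename (e a) (w a))` for `a ≤ 3`, with `w a = aeval (σ a) F` the dehomogenisation and `e a` the increasing embedding of the
remaining three variables (`F` cubic: `F(θ_a) = X_a³·F|_{X_a = 1}`). [folklore; cite: Kollar2007, §2.5] -/
theorem theta_castSucc (F : MvPolynomial (Fin 4) k) (hF : F.IsHomogeneous 3) (f : MvPolynomial (Fin 5) k) (hf : f = X 4 ^ 2 + rename (Fin.castSucc : Fin 4 → Fin 5) F)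
    (a : Fin 4) :
    MvPolynomial.aeval (fun j : Fin 5 => if j = Fin.castSucc a then (X (Fin.castSucc a) : MvPolynomial (Fin 5) k) else X j * X (Fin.castSucc a)) f =
      X (Fin.castSucc a) ^ 2 * (X 4 ^ 2 + X (Fin.castSucc a) *
        rename ((![![1, 2, 3], ![0, 2, 3], ![0, 1, 3], ![0, 1, 2]] : Fin 4 → Fin 3 → Fin 5) a)
          (MvPolynomial.aeval ((![![1, X 0, X 1, X 2], ![X 0, 1, X 1, X 2], ![X 0, X 1, 1, X 2], ![X 0, X 1, X 2, 1]] :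
            Fin 4 → Fin 4 → MvPolynomial (Fin 3) k) a) F)) := by
  -- `θ_a` on `k[X₀..X₃]` is the scaling by `X_a` of the substitution `g : Y_a ↦ 1, Y_j ↦ X_j`
  have hcomp : MvPolynomial.aeval (fun j : Fin 5 => if j = Fin.castSucc a then (X (Fin.castSucc a) : MvPolynomial (Fin 5) k) else X j * X (Fin.castSucc a))
      (rename (Fin.castSucc : Fin 4 → Fin 5) F) =
      MvPolynomial.aeval (fun j : Fin 4 => (X (Fin.castSucc a) : MvPolynomial (Fin 5) k) * (if j = a then 1 else X (Fin.castSucc j))) F := by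
    rw [aeval_rename, show ((fun j : Fin 5 => if j = Fin.castSucc a then (X (Fin.castSucc a) : MvPolynomial (Fin 5) k) else X j * X (Fin.castSucc a)) ∘ Fin.castSucc) =
      (fun j : Fin 4 => (X (Fin.castSucc a) : MvPolynomial (Fin 5) k) * (if j = a then 1 else X (Fin.castSucc j))) from funext fun j => by
        simp only [Function.comp_apply]
        by_cases hj : j = a
        · subst hj; rw [if_pos rfl, if_pos rfl, mul_one]
        · rw [if_neg (fun h => hj (Fin.castSucc_injective _ h)), if_neg hj, mul_comm]]
  have hscale := aeval_mul_of_isHomogeneous hF (X (Fin.castSucc a) : MvPolynomial (Fin 5) k) (fun j : Fin 4 => if j = a then (1 : MvPolynomial (Fin 5) k) else X (Fin.castSucc j))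
  -- the substitution `g` equals `rename (e a) ∘ σ a`
  have hsub : MvPolynomial.aeval (fun j : Fin 4 => if j = a then (1 : MvPolynomial (Fin 5) k) else X (Fin.castSucc j)) F =
      rename ((![![1, 2, 3], ![0, 2, 3], ![0, 1, 3], ![0, 1, 2]] : Fin 4 → Fin 3 → Fin 5) a)
        (MvPolynomial.aeval ((![![1, X 0, X 1, X 2], ![X 0, 1, X 1, X 2], ![X 0, X 1, 1, X 2], ![X 0, X 1, X 2, 1]] :
          Fin 4 → Fin 4 → MvPolynomial (Fin 3) k) a) F) := by
    have hhom : (MvPolynomial.aeval (fun j : Fin 4 => if j = a then (1 : MvPolynomial (Fin 5) k) else X (Fin.castSucc j)) : MvPolynomial (Fin 4) k →ₐ[k] _) =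
        (rename ((![![1, 2, 3], ![0, 2, 3], ![0, 1, 3], ![0, 1, 2]] : Fin 4 → Fin 3 → Fin 5) a)).comp
          (MvPolynomial.aeval ((![![1, X 0, X 1, X 2], ![X 0, 1, X 1, X 2], ![X 0, X 1, 1, X 2], ![X 0, X 1, X 2, 1]] :
            Fin 4 → Fin 4 → MvPolynomial (Fin 3) k) a)) := by
      refine MvPolynomial.algHom_ext fun j => ?_
      rw [aeval_X, AlgHom.comp_apply, aeval_X]
      fin_cases a <;> fin_cases j <;> simp
    rw [hhom]
    rfl
  have h4 : (4 : Fin 5) ≠ Fin.castSucc a := fun h => (Fin.castSucc_lt_last a).ne h.symm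
  rw [hf, map_add, map_pow, aeval_X, if_neg h4, hcomp, hscale, hsub]
  ring

/-- `f = X₄² + F ∉ (Xᵢ)` for every `i`, as soon as `F ≠ 0` (`i = 4`: kill `X₄`; `i ≤ 3`: evaluate at `e₄`). [elementary] -/
theorem f_not_mem_span_X (F : MvPolynomial (Fin 4) k) (hF : F.IsHomogeneous 3) (hF0 : F ≠ 0) (f : MvPolynomial (Fin 5) k)
    (hf : f = X 4 ^ 2 + rename (Fin.castSucc : Fin 4 → Fin 5) F) (i : Fin 5) : f ∉ Ideal.span {(X i : MvPolynomial (Fin 5) k)} := by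
  intro h
  obtain ⟨c, hc⟩ := Ideal.mem_span_singleton.mp h
  by_cases hi : i = 4
  · subst hi
    -- kill `X₄`: `F = 0`
    have := congrArg (MvPolynomial.aeval (fun j : Fin 5 => if j = (4 : Fin 5) then (0 : MvPolynomial (Fin 5) k) else X j)) hc
    rw [hf, map_add, map_pow, map_mul, aeval_X, if_pos rfl, aeval_rename] at this
    simp only [ne_eq, OfNat.ofNat_ne_zero, not_false_eq_true, zero_pow, zero_add, zero_mul] at this
    have hid : MvPolynomial.aeval ((fun j : Fin 5 => if j = (4 : Fin 5) then (0 : MvPolynomial (Fin 5) k) else X j) ∘ Fin.castSucc) F =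
        rename (Fin.castSucc : Fin 4 → Fin 5) F := by
      rw [show ((fun j : Fin 5 => if j = (4 : Fin 5) then (0 : MvPolynomial (Fin 5) k) else X j) ∘ Fin.castSucc) = X ∘ Fin.castSucc from
        funext fun j => by
          have hj4 : Fin.castSucc j ≠ (4 : Fin 5) := (Fin.castSucc_lt_last j).ne
          simp only [Function.comp_apply]; rw [if_neg hj4], ← aeval_rename, aeval_X_left_apply]
    rw [hid] at this
    exact hF0 (rename_injective _ (Fin.castSucc_injective _) (by rw [this, map_zero]))
  · -- evaluate at `e₄`
    have := congrArg (MvPolynomial.eval (Pi.single 4 1 : Fin 5 → k)) hc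
    rw [hf, map_add, map_pow, map_mul, eval_X, eval_X, Pi.single_eq_same, Pi.single_eq_of_ne hi, zero_mul, eval_rename] at this
    have h0 : MvPolynomial.eval ((Pi.single (4 : Fin 5) (1 : k)) ∘ Fin.castSucc) F = 0 := by
      have hfun : ((Pi.single (4 : Fin 5) (1 : k)) ∘ Fin.castSucc : Fin 4 → k) = 0 := by
        funext j
        simp only [Function.comp_apply, Pi.zero_apply]
        exact Pi.single_eq_of_ne (Fin.castSucc_lt_last j).ne _
      rw [hfun, eval_zero]
      exact constantCoeff_eq_zero_of_isHomogeneous hF (by norm_num)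
    rw [h0] at this
    norm_num at this

/-- `f = X₄² + F` has no constant term. [elementary] -/
theorem constantCoeff_f (F : MvPolynomial (Fin 4) k) (hF : F.IsHomogeneous 3) (f : MvPolynomial (Fin 5) k) (hf : f = X 4 ^ 2 + rename (Fin.castSucc : Fin 4 → Fin 5) F) :
    constantCoeff f = 0 := by
  rw [hf, map_add, map_pow, constantCoeff_X, constantCoeff_rename, constantCoeff_eq_zero_of_isHomogeneous hF (by norm_num)]
  norm_num

/-! ## §3 The class theorem for cubic forms -/

/-- ★★★ **T-SIDE CLASS ROW FOR CUBIC FORMS.** Let `F ∈ k[Y₀,…,Y₃]` be homogeneous of degree `3`, `f = X₄² + F(X₀,…,X₃)`, `Y = Spec k[X]/(f)`, `v` the origin. Assume: `f` is PRIME, `Y` is regular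
off `v`, and each dehomogenisation `w a = F|_{Y_a = 1} ∈ k[Z₀,Z₁,Z₂]` (`a = 0,…,3`) is PRIME with SMOOTH zero locus (`∀` prime `Q ∋ w a` `∃` derivation `D`, `D (w a) ∉ Q`). Then for every `p`:
`TStepGerm.TStepInstanceAt p v (𝔪̃·𝒪_{Y,v})` — for every blowing up of `Spec 𝒪_{Y,v}` along the point floor (regular off the closed fibre, FULL), ONE blowing up along the reduced singular
locus (the smooth irreducible cubic surface `{F = 0} ⊂ ℙ³ = E_red`, transversal type A₁) has ALL its blowings up REGULAR. Every field, every characteristic. The Fermat form `F = ΣY_j³`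
(`p ∤ 6`) is T-instance #2 ✓p676607. [OURS · class-level certificate theorem; cite: GortzWedhorn2020, Prop. 13.91 (2); Liu2002, Thm. 8.1.19 (a); StacksProject, Tag 07PF] -/
theorem tStepInstanceAt_of_doublePoint_cubicForm (p : ℕ) (F : MvPolynomial (Fin 4) k) (hF : F.IsHomogeneous 3) (f : MvPolynomial (Fin 5) k)
    (hf : f = X 4 ^ 2 + rename (Fin.castSucc : Fin 4 → Fin 5) F) (hprime : Prime f)
    (hoff : ∀ (P : Ideal (MvPolynomial (Fin 5) k ⧸ Ideal.span {f})) [P.IsPrime],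
      ¬ Ideal.span (Set.range fun j : Fin 5 => Ideal.Quotient.mk (Ideal.span {f}) (X j)) ≤ P → IsRegularLocalRing (Localization.AtPrime P))
    (hw : ∀ a : Fin 4, Prime (MvPolynomial.aeval ((![![1, X 0, X 1, X 2], ![X 0, 1, X 1, X 2], ![X 0, X 1, 1, X 2], ![X 0, X 1, X 2, 1]] :
      Fin 4 → Fin 4 → MvPolynomial (Fin 3) k) a) F))
    (hws : ∀ (a : Fin 4) (Q : Ideal (MvPolynomial (Fin 3) k)), Q.IsPrime →
      MvPolynomial.aeval ((![![1, X 0, X 1, X 2], ![X 0, 1, X 1, X 2], ![X 0, X 1, 1, X 2], ![X 0, X 1, X 2, 1]] : Fin 4 → Fin 4 → MvPolynomial (Fin 3) k) a) F ∈ Q →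
      ∃ D : Derivation k (MvPolynomial (Fin 3) k) (MvPolynomial (Fin 3) k),
        D (MvPolynomial.aeval ((![![1, X 0, X 1, X 2], ![X 0, 1, X 1, X 2], ![X 0, X 1, 1, X 2], ![X 0, X 1, X 2, 1]] : Fin 4 → Fin 4 → MvPolynomial (Fin 3) k) a) F) ∉ Q)
    (v : Spec (.of (MvPolynomial (Fin 5) k ⧸ Ideal.span {f})))
    (hv : v.asIdeal = Ideal.span (Set.range fun j : Fin 5 => Ideal.Quotient.mk (Ideal.span {f}) (X j))) :
    TStepGerm.TStepInstanceAt p v ((affineBlowup.idealSheaf (Ideal.span (Set.range fun j : Fin 5 => Ideal.Quotient.mk (Ideal.span {f}) (X j)))).comap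
      ((Spec (.of (MvPolynomial (Fin 5) k ⧸ Ideal.span {f}))).fromSpecStalk v)) := by
  have hF0 : F ≠ 0 := by
    intro h0
    have := (hw 0).ne_zero
    rw [h0, map_zero] at this
    exact this rfl
  -- the strict transforms
  obtain ⟨G, hG⟩ : ∃ G : Fin 5 → MvPolynomial (Fin 5) k, G = fun i : Fin 5 =>
      if h : i = 4 then 1 + X 4 * rename (Fin.castSucc : Fin 4 → Fin 5) F
      else X 4 ^ 2 + X i * rename ((![![1, 2, 3], ![0, 2, 3], ![0, 1, 3], ![0, 1, 2]] : Fin 4 → Fin 3 → Fin 5) (i.castPred h))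
        (MvPolynomial.aeval ((![![1, X 0, X 1, X 2], ![X 0, 1, X 1, X 2], ![X 0, X 1, 1, X 2], ![X 0, X 1, X 2, 1]] :
          Fin 4 → Fin 4 → MvPolynomial (Fin 3) k) (i.castPred h)) F) := ⟨_, rfl⟩
  have hG4 : G 4 = 1 + X 4 * rename (Fin.castSucc : Fin 4 → Fin 5) F := by rw [hG]; simp
  have hGw : ∀ a : Fin 4, G (Fin.castSucc a) = X 4 ^ 2 + X (Fin.castSucc a) *
      rename ((![![1, 2, 3], ![0, 2, 3], ![0, 1, 3], ![0, 1, 2]] : Fin 4 → Fin 3 → Fin 5) a)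
        (MvPolynomial.aeval ((![![1, X 0, X 1, X 2], ![X 0, 1, X 1, X 2], ![X 0, X 1, 1, X 2], ![X 0, X 1, X 2, 1]] :
          Fin 4 → Fin 4 → MvPolynomial (Fin 3) k) a) F) := by
    intro a
    have ha4 : Fin.castSucc a ≠ (4 : Fin 5) := (Fin.castSucc_lt_last a).ne
    rw [hG]
    dsimp only
    rw [dif_neg ha4, Fin.castPred_castSucc]
  have hθ : ∀ i : Fin 5, MvPolynomial.aeval (fun j : Fin 5 => if j = i then (X i : MvPolynomial (Fin 5) k) else X j * X i) f = X i ^ 2 * G i := by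
    intro i
    by_cases hi : i = 4
    · subst hi; rw [hG4]; exact theta_four k F hF f hf
    · have : i = Fin.castSucc (i.castPred hi) := (Fin.castSucc_castPred i hi).symm
      rw [this, hGw]
      exact theta_castSucc k F hF f hf _
  exact X2CubicFormTStep.tStepInstanceAt_of_doublePoint_cubicCharts k p f hprime (constantCoeff_f k F hF f hf) (f_not_mem_span_X k F hF hF0 f hf) hoff G hθ _ hGw hw hws
    _ hG4 (pderiv_rename_castSucc k F) v hv

end Summit.ResolutionOfSingularities.ResolutionOfSingularities.Theorems.FInjectiveMacaulayfication.X2CubicFormFrontEnd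

end
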